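import Literature.AnabelianGeometry.EtaleTheta.Discharge.Sec2OuterPairOfCLevelData
import Literature.AnabelianGeometry.EtaleTheta.SettingModelMuTwoInversionCLevel
import Literature.AnabelianGeometry.EtaleTheta.SettingModelOriginProfile
import HarnessLib

/-!
# [EtTh] §2, OUTER conjugators: the automorphism pair EXISTS at the inversion model (non-vacuity)

Mochizuki, *The Étale Theta Function …* [EtTh], Publ. RIMS 45 (2009), Def 1.7 p.27 (`X^log → C^log`, the inversion),
Thm 1.6 (ii) p.24 (theta companions), Cor 2.8 (iii) p.42 [cite: MochizukiEtTh2009, Cor 2.8(iii) p.42].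

PROOF-ONLY non-vacuity companion (no `def`, no instance, no new `Prop`; cell abc-iut, layer L2, seat abc-iut-w6-d051) of
`Discharge/Sec2OuterPairOfCLevelData` (p438180): its two hypotheses — a `MuTwoSetting.CLevelData` and
`IsQuotientMap toTheta` — are JOINTLY witnessed in the tree, at abc-iut-L2-t6/L6-lineage's inversion model
`MuTwoSetting.inversionModel p` (`SettingModelMuTwoInversionCLevel`: `inversionModel_cLevelData`, whose `ε_±` is a GENUINE
inversion; base `ThetaSetting.model p`, where `toTheta` is a quotient map — abc-iut-L2-t1-lineage's
`SettingModel.model_isQuotientMap_toTheta`). Hence, there, EVERY `g ∈ Π^tp_C` (in particular the inversion representative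
`ε_±`) carries an automorphism pair `(α, β)` with `inclX ∘ α = conj_g ∘ inclX`, `β ∘ toTheta = toTheta ∘ α`,
`β^{±1}(Δ_Θ) ⊆ Δ_Θ` — the residual «pair equations» of the OUTER Cor 2.8 chain (p436384 / p436513 / p437630) is satisfiable
at a concrete typed `MuTwoSetting`. A statement about the cell's MODEL, not about an actual curve; [EtTh] is refereed; no
side is taken on [IUTchIII] Cor 3.12; typed ≠ proved; witnessed ≠ discharged-at-the-genuine-curve.
-/

noncomputable section

namespace Literature.AnabelianGeometry.EtaleTheta

open _root_.Topology

namespace MuTwoSetting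

/-- **Non-vacuity of the outer pair**: at the inversion model `MuTwoSetting.inversionModel p`, every `g ∈ Π^tp_C` has an
automorphism pair `(α, β)` with the two pair equations and `β^{±1}(Δ_Θ) ⊆ Δ_Θ` (`CLevelData.exists_outer_pair` at
`inversionModel_cLevelData` and `SettingModel.model_isQuotientMap_toTheta`). [cite: MochizukiEtTh2009, Cor 2.8(iii) p.42] -/
theorem exists_outer_pair_inversionModel (p : ℕ) [Fact p.Prime] (g : (inversionModel p).GtpC) :
    ∃ (α : (inversionModel p).PiTemp ≃ₜ* (inversionModel p).PiTemp)
      (β : (inversionModel p).GtpTheta ≃ₜ* (inversionModel p).GtpTheta),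
      (∀ σ, (inversionModel p).inclX (α σ) = g * (inversionModel p).inclX σ * g⁻¹) ∧
      (∀ σ, β ((inversionModel p).toTheta σ) = (inversionModel p).toTheta (α σ)) ∧
      (∀ a, a ∈ (inversionModel p).DeltaTheta → β a ∈ (inversionModel p).DeltaTheta) ∧
      (∀ a, a ∈ (inversionModel p).DeltaTheta → β.symm a ∈ (inversionModel p).DeltaTheta) :=
  (inversionModel_cLevelData p).exists_outer_pair (SettingModel.model_isQuotientMap_toTheta p) g

/-- In particular for the GENUINE inversion representative `ε_± ∈ Π^tp_C ∖ Π^tp_X` of the model (the outer conjugator of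
Cor 2.8 (iii)'s clauses 3–4). [cite: MochizukiEtTh2009, Cor 2.8(iii) p.42] -/
theorem exists_outer_pair_inversionModel_epsPM (p : ℕ) [Fact p.Prime] :
    ∃ (α : (inversionModel p).PiTemp ≃ₜ* (inversionModel p).PiTemp)
      (β : (inversionModel p).GtpTheta ≃ₜ* (inversionModel p).GtpTheta),
      (∀ σ, (inversionModel p).inclX (α σ) =
        (inversionModel p).epsPM * (inversionModel p).inclX σ * ((inversionModel p).epsPM)⁻¹) ∧
      (∀ σ, β ((inversionModel p).toTheta σ) = (inversionModel p).toTheta (α σ)) ∧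
      (∀ a, a ∈ (inversionModel p).DeltaTheta → β a ∈ (inversionModel p).DeltaTheta) ∧
      (∀ a, a ∈ (inversionModel p).DeltaTheta → β.symm a ∈ (inversionModel p).DeltaTheta) :=
  exists_outer_pair_inversionModel p (inversionModel p).epsPM

end MuTwoSetting

end Literature.AnabelianGeometry.EtaleTheta

end
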